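import Mathlib.RingTheory.AdjoinRoot
import Mathlib.Algebra.Polynomial.SpecificDegree
import Mathlib.Algebra.Polynomial.Degree.SmallDegree
import Mathlib.Data.ZMod.Basic
import Mathlib.Algebra.Field.ZMod
import Mathlib.Tactic.NormNum.Prime
import Mathlib.Tactic.FieldSimp
import Mathlib.Tactic.LinearCombination
import Mathlib.Tactic.Ring
import Mathlib.Tactic.NormNum

/-!
HONEST FRAMING: per-curve certified theorems and census instruments; no claim on BSD in rank ≥ 2.

# KERNEL-3ISO kit G — norm-form certificates for the E-side charts at large primes (cert-1 gen 10)

The E-side certificate kit (`Rank2ObservatoryThreeIsoCertE.lean`, `ThreeIso.descent_mem_of_certs`) asks, per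
certificate `((v, p, k), (g, l₁, l₂, l₃), (A, B, C, D))`, for the three affine charts of the cubic
`A X³ + B Y³ + C Z³ + D XYZ` to have no zero modulo `p ^ k` — three bounded, kernel-decidable enumerations of
`p ^ (2k)` points each.  For three census rows (`118860k1`, `349734v1`, `482118y1`) the only locally insoluble
prime of the class that has to be killed is large (`p = 283, 757, 883`, level `k = 1`), far beyond what a kernel
enumeration can do.  At such a prime the cubic is a TWISTED NORM FORM: with `b ≡ B·A⁻¹`, `μ ≡ −D·(3B)⁻¹ (mod p)`
and `D³ + 27·A·B·C ≡ 0 (mod p)` one has `A X³ + B Y³ + C Z³ + D XYZ ≡ A · N(X + θ Y + μ θ² Z)` where `θ³ = b` and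
`N(x + θ y + θ² w) = x³ + b y³ + b² w³ − 3 b x y w` is the norm form of `𝔽_p(θ)`; if `b` is not a cube modulo `p`
then `X³ − b` is irreducible, `𝔽_p(θ) = 𝔽_p[X]/(X³ − b)` is a field, and the norm form is ANISOTROPIC, so the
cubic has no nontrivial zero modulo `p` at all — in particular none on any of the three charts.

This file proves exactly that, with every hypothesis an integer congruence the rows discharge by `decide`:
* `ThreeIso.normForm_anisotropic` — over any field, `b` not a cube ⇒ `x³ + b y³ + b² w³ − 3 b x y w = 0 → x = y = w = 0`
  (via `AdjoinRoot (X³ − C b)`, the identity `ξ · adj ξ = N(ξ)` and a degree argument);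
* `ThreeIso.cubic_anisotropic_mod` — the twisted version over `ZMod p` from the witnesses `b, μ`;
* `ThreeIso.chartsE_empty_of_normForm` — the three chart clauses of kit E at level `k = 1`, in the exact shape
  `ThreeIso.descent_mem_of_certs` consumes.
References: H. Cohen, *Number Theory I* (GTM 239), §8.4 (3-descent with a rational 3-isogeny; local solubility of the
cubic torsors); H. Cohen, F. Pazuki, *Elementary 3-descent with a 3-isogeny*, Acta Arith. 140 (2009), §§2–4; the
anisotropy of norm forms of field extensions is classical (e.g. J.-P. Serre, *A Course in Arithmetic*, Ch. I–IV for
forms over finite fields).  Theorems only; axioms standard; no `native_decide`.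
-/

set_option linter.dupNamespace false

namespace Summit.BirchSwinnertonDyer.BirchSwinnertonDyer.Rank2Observatory.ThreeIso

open Polynomial

/-- Coordinates in `AdjoinRoot (X³ − C b)`: if `x + y θ + w θ² = 0` then `x = y = w = 0` (degree argument:
`X³ − C b` divides the quadratic `C w X² + C y X + C x`, which is therefore `0`). [folklore] -/
theorem coords_eq_zero_of_adjoinRoot {F : Type*} [Field F] (b x y w : F)
    (h : AdjoinRoot.of (X ^ 3 - C b) x + AdjoinRoot.of (X ^ 3 - C b) y * AdjoinRoot.root (X ^ 3 - C b) +
      AdjoinRoot.of (X ^ 3 - C b) w * AdjoinRoot.root (X ^ 3 - C b) ^ 2 = 0) :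
    x = 0 ∧ y = 0 ∧ w = 0 := by
  set f : F[X] := X ^ 3 - C b with hf
  have hdegf : f.degree = 3 := by
    rw [hf]; exact degree_X_pow_sub_C (by norm_num) b
  set g : F[X] := C w * X ^ 2 + C y * X + C x with hg
  have hmk : AdjoinRoot.mk f g = 0 := by
    rw [← AdjoinRoot.aeval_eq]
    simp only [hg, map_add, map_mul, map_pow, aeval_C, aeval_X, AdjoinRoot.algebraMap_eq]
    rw [← h]; ring
  have hdvd : f ∣ g := AdjoinRoot.mk_eq_zero.mp hmk
  have hg0 : g = 0 := by
    refine Polynomial.eq_zero_of_dvd_of_degree_lt hdvd ?_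
    rw [hdegf, hg]; exact degree_quadratic_lt
  have h0 := congrArg (fun q : F[X] => q.coeff 0) hg0
  have h1 := congrArg (fun q : F[X] => q.coeff 1) hg0
  have h2 := congrArg (fun q : F[X] => q.coeff 2) hg0
  simp only [hg, coeff_add, coeff_C_mul, coeff_X_pow, coeff_X, coeff_C, coeff_zero] at h0 h1 h2
  norm_num at h0 h1 h2
  exact ⟨h0, h1, h2⟩

/-- The identity `ξ · adj ξ = N(ξ)` for `ξ = x + y θ + w θ²` with `θ³ = b`, in any commutative ring. [folklore] -/
theorem mul_adj_eq_norm {F K : Type*} [Field F] [CommRing K] (ι : F →+* K) (θ : K) (b : F) (hθ : θ ^ 3 = ι b)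
    (x y w : F) :
    (ι x + ι y * θ + ι w * θ ^ 2) *
        (ι (x ^ 2 - b * y * w) + ι (b * w ^ 2 - x * y) * θ + ι (y ^ 2 - x * w) * θ ^ 2) =
      ι (x ^ 3 + b * y ^ 3 + b ^ 2 * w ^ 3 - 3 * b * (x * y * w)) := by
  simp only [map_add, map_sub, map_mul, map_pow, map_ofNat]
  linear_combination (ι y ^ 3 + ι b * ι w ^ 3 - 2 * (ι x * ι y * ι w) + ι w * (ι y ^ 2 - ι x * ι w) * θ) * hθ

/-- **Anisotropy of the cubic norm form.** Over a field `F`, if `b` is not a cube then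
`x³ + b y³ + b² w³ − 3 b x y w = 0` forces `x = y = w = 0`.  Proof: in `K = F[X]/(X³ − b)` (a field, since a cubic
without roots is irreducible) `ξ = x + yθ + wθ²` and `adj ξ = (x² − b y w) + (b w² − x y) θ + (y² − x w) θ²` satisfy
`ξ · adj ξ = N`; so `ξ = 0` or `adj ξ = 0`, and either way the coordinates vanish (the second case would make `b`
the cube `(y / w)³`). [folklore] -/
theorem normForm_anisotropic {F : Type*} [Field F] (b : F) (hb : ∀ t : F, t ^ 3 ≠ b) (x y w : F)
    (h : x ^ 3 + b * y ^ 3 + b ^ 2 * w ^ 3 - 3 * b * (x * y * w) = 0) : x = 0 ∧ y = 0 ∧ w = 0 := by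
  have hirr : Irreducible (X ^ 3 - C b : F[X]) := by
    refine Polynomial.irreducible_of_degree_le_three_of_not_isRoot (by rw [natDegree_X_pow_sub_C]; decide)
      (fun t ht => hb t ?_)
    simpa [sub_eq_zero] using ht
  haveI : Fact (Irreducible (X ^ 3 - C b : F[X])) := ⟨hirr⟩
  have hθ : AdjoinRoot.root (X ^ 3 - C b : F[X]) ^ 3 = AdjoinRoot.of (X ^ 3 - C b : F[X]) b := by
    have h0 := AdjoinRoot.eval₂_root (X ^ 3 - C b : F[X])
    simp only [eval₂_sub, eval₂_X_pow, eval₂_C] at h0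
    exact sub_eq_zero.mp h0
  have key := mul_adj_eq_norm (AdjoinRoot.of (X ^ 3 - C b : F[X])) (AdjoinRoot.root (X ^ 3 - C b : F[X])) b hθ x y w
  rw [h, map_zero] at key
  rcases mul_eq_zero.mp key with h1 | h2
  · exact coords_eq_zero_of_adjoinRoot b x y w h1
  · obtain ⟨e1, e2, e3⟩ := coords_eq_zero_of_adjoinRoot b _ _ _ h2
    -- e1 : x² − b y w = 0, e2 : b w² − x y = 0, e3 : y² − x w = 0
    by_cases hw : w = 0
    · subst hw
      have hy : y = 0 := by simpa using e3
      subst hy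
      have hx : x = 0 := by simpa using e1
      exact ⟨hx, rfl, rfl⟩
    · exfalso
      have e2' : b * w ^ 2 = x * y := sub_eq_zero.mp e2
      have e3' : y ^ 2 = x * w := sub_eq_zero.mp e3
      have hcube : b * w ^ 3 = y ^ 3 := by linear_combination w * e2' - y * e3'
      refine hb (y / w) ?_
      rw [div_pow, div_eq_iff (pow_ne_zero 3 hw)]
      linear_combination (-1 : F) * hcube

/-- **The twisted norm form modulo `p` is anisotropic.**  Integers `A, B, C, D`, a prime `p` and witnesses `b, μ`
with `A·b ≡ B`, `3·B·μ ≡ −D`, `A·b²·μ³ ≡ C (mod p)`, `A, μ ≢ 0` and `b` not a cube modulo `p`: then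
`A x³ + B y³ + C z³ + D x y z = 0` in `ZMod p` forces `x = y = z = 0`
(indeed `A x³ + B y³ + C z³ + D xyz = A · N(x, y, μ z)` for the norm form of `θ³ = b`).
[cite: Cohen2007NumberTheoryI, §8.4] [folklore] -/
theorem cubic_anisotropic_mod (A B C D : ℤ) (p : ℕ) (hp : p.Prime) (b μ : ℤ)
    (h1 : (A * b) % (p : ℤ) = B % (p : ℤ)) (h2 : (3 * B * μ) % (p : ℤ) = (-D) % (p : ℤ))
    (h3 : (A * b ^ 2 * μ ^ 3) % (p : ℤ) = C % (p : ℤ))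
    (hA : A % (p : ℤ) ≠ 0) (hμ : μ % (p : ℤ) ≠ 0) (hb : ∀ t : ℕ, t < p → ((t : ℤ) ^ 3 - b) % (p : ℤ) ≠ 0)
    (x y z : ZMod p) (h : (A : ZMod p) * x ^ 3 + (B : ZMod p) * y ^ 3 + (C : ZMod p) * z ^ 3 +
      (D : ZMod p) * (x * y * z) = 0) : x = 0 ∧ y = 0 ∧ z = 0 := by
  haveI : Fact p.Prime := ⟨hp⟩
  have h1' : (A : ZMod p) * (b : ZMod p) = (B : ZMod p) := by
    have := (ZMod.intCast_eq_intCast_iff' (A * b) B p).mpr h1; push_cast at this; exact this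
  have h2' : 3 * (B : ZMod p) * (μ : ZMod p) = -(D : ZMod p) := by
    have := (ZMod.intCast_eq_intCast_iff' (3 * B * μ) (-D) p).mpr h2; push_cast at this; exact this
  have h3' : (A : ZMod p) * (b : ZMod p) ^ 2 * (μ : ZMod p) ^ 3 = (C : ZMod p) := by
    have := (ZMod.intCast_eq_intCast_iff' (A * b ^ 2 * μ ^ 3) C p).mpr h3; push_cast at this; exact this
  have hA' : (A : ZMod p) ≠ 0 := by
    intro h0; exact hA (Int.emod_eq_zero_of_dvd ((ZMod.intCast_zmod_eq_zero_iff_dvd A p).mp h0))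
  have hμ' : (μ : ZMod p) ≠ 0 := by
    intro h0; exact hμ (Int.emod_eq_zero_of_dvd ((ZMod.intCast_zmod_eq_zero_iff_dvd μ p).mp h0))
  have hb' : ∀ t : ZMod p, t ^ 3 ≠ (b : ZMod p) := by
    intro t ht
    apply hb t.val (ZMod.val_lt t)
    apply Int.emod_eq_zero_of_dvd
    apply (ZMod.intCast_zmod_eq_zero_iff_dvd _ p).mp
    push_cast
    rw [ZMod.natCast_zmod_val, ht, sub_self]
  have key : (A : ZMod p) * (x ^ 3 + (b : ZMod p) * y ^ 3 + (b : ZMod p) ^ 2 * ((μ : ZMod p) * z) ^ 3 -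
      3 * (b : ZMod p) * (x * y * ((μ : ZMod p) * z))) = 0 := by
    rw [← h]
    linear_combination (y ^ 3 - 3 * (μ : ZMod p) * (x * y * z)) * h1' + z ^ 3 * h3' - (x * y * z) * h2'
  rcases mul_eq_zero.mp key with hA0 | hN
  · exact absurd hA0 hA'
  · obtain ⟨hx, hy, hμz⟩ := normForm_anisotropic (b : ZMod p) hb' x y ((μ : ZMod p) * z) hN
    refine ⟨hx, hy, ?_⟩
    rcases mul_eq_zero.mp hμz with h0 | h0
    · exact absurd h0 hμ'
    · exact h0

/-- **Kit G for the rows.** Under the hypotheses of `cubic_anisotropic_mod` (all integer congruences, decidable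
in the kernel), the three chart clauses of kit E (`ThreeIso.descent_mem_of_certs`) hold at level `k = 1`:
none of `A + B b'³ + C d³ + D b'd`, `A a³ + B + C d³ + D a d`, `A a³ + B b'³ + C + D a b'` vanishes modulo `p`.
[cite: Cohen2007NumberTheoryI, §8.4] [cite: CohenPazuki2009, Thm. 3.1] -/
theorem chartsE_empty_of_normForm (A B C D : ℤ) (p : ℕ) (hp : p.Prime) (b μ : ℤ)
    (h1 : (A * b) % (p : ℤ) = B % (p : ℤ)) (h2 : (3 * B * μ) % (p : ℤ) = (-D) % (p : ℤ))
    (h3 : (A * b ^ 2 * μ ^ 3) % (p : ℤ) = C % (p : ℤ))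
    (hA : A % (p : ℤ) ≠ 0) (hμ : μ % (p : ℤ) ≠ 0) (hb : ∀ t : ℕ, t < p → ((t : ℤ) ^ 3 - b) % (p : ℤ) ≠ 0) :
    (∀ b' : ℕ, b' < p ^ 1 → ∀ d : ℕ, d < p ^ 1 →
        (A + B * (b' : ℤ) ^ 3 + C * (d : ℤ) ^ 3 + D * ((b' : ℤ) * (d : ℤ))) % ((p ^ 1 : ℕ) : ℤ) ≠ 0) ∧
    (∀ a : ℕ, a < p ^ 1 → ∀ d : ℕ, d < p ^ 1 →
        (A * (a : ℤ) ^ 3 + B + C * (d : ℤ) ^ 3 + D * ((a : ℤ) * (d : ℤ))) % ((p ^ 1 : ℕ) : ℤ) ≠ 0) ∧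
    (∀ a : ℕ, a < p ^ 1 → ∀ b' : ℕ, b' < p ^ 1 →
        (A * (a : ℤ) ^ 3 + B * (b' : ℤ) ^ 3 + C + D * ((a : ℤ) * (b' : ℤ))) % ((p ^ 1 : ℕ) : ℤ) ≠ 0) := by
  haveI : Fact p.Prime := ⟨hp⟩
  have one_ne : (1 : ZMod p) ≠ 0 := one_ne_zero
  -- from an integer vanishing modulo `p` to an equation in `ZMod p`
  have cast0 : ∀ E : ℤ, E % ((p ^ 1 : ℕ) : ℤ) = 0 → (E : ZMod p) = 0 := fun E hE =>
    (ZMod.intCast_zmod_eq_zero_iff_dvd E p).mpr (Int.dvd_of_emod_eq_zero (by simpa using hE))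
  refine ⟨fun b' _ d _ hE => ?_, fun a _ d _ hE => ?_, fun a _ b' _ hE => ?_⟩
  · have h0 := cast0 _ hE
    push_cast at h0
    have := (cubic_anisotropic_mod A B C D p hp b μ h1 h2 h3 hA hμ hb 1 (b' : ZMod p) (d : ZMod p)
      (by linear_combination h0)).1
    exact one_ne this
  · have h0 := cast0 _ hE
    push_cast at h0
    have := (cubic_anisotropic_mod A B C D p hp b μ h1 h2 h3 hA hμ hb (a : ZMod p) 1 (d : ZMod p)
      (by linear_combination h0)).2.1
    exact one_ne this
  · have h0 := cast0 _ hE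
    push_cast at h0
    have := (cubic_anisotropic_mod A B C D p hp b μ h1 h2 h3 hA hμ hb (a : ZMod p) (b' : ZMod p) 1
      (by linear_combination h0)).2.2
    exact one_ne this

/-- Smoke test on the smallest case the rows need (`p = 7`, `A = 1`, `B = 2`, `C = 4·(−1)³·… `): the cubic
`X³ + 2 Y³ + 4 Z³ − 6 XYZ` is the norm form of `𝔽₇(∛2)` itself (`b = 2`, `μ = 1`; `2` is not a cube mod `7`). -/
example : ∀ b' : ℕ, b' < 7 ^ 1 → ∀ d : ℕ, d < 7 ^ 1 →
    ((1 : ℤ) + 2 * (b' : ℤ) ^ 3 + 4 * (d : ℤ) ^ 3 + (-6) * ((b' : ℤ) * (d : ℤ))) % ((7 ^ 1 : ℕ) : ℤ) ≠ 0 :=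
  (chartsE_empty_of_normForm 1 2 4 (-6) 7 (by norm_num) 2 1 (by decide) (by decide) (by decide) (by decide)
    (by decide) (by decide)).1

end Summit.BirchSwinnertonDyer.BirchSwinnertonDyer.Rank2Observatory.ThreeIso
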